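import Literature.AnabelianGeometry.EtaleTheta.TemperedFrobenioidCor38SubOTriNegative
import HarnessLib

/-!
# [EtTh] Def. 3.6 (ii) over the POSITIVE CONES of [FrdI] Example 3.9 — a typed tempered Frobenioid whose base
# `SingleObj (ℚ_{≥0} ⋊ N)` has non-invertible translations (toy data, part 1 of 3)

S. Mochizuki, *The étale theta function and its Frobenioid-theoretic manifestations*, Publ. RIMS **45** (2009),
Def. 3.3 (iii) p. 73, Def. 3.6 (i)–(ii) pp. 76–77 [cite: MochizukiEtTh2009, Def 3.6 p.77]; S. Mochizuki, *The
geometry of Frobenioids I*, Kyushu J. Math. **62** (2008), Example 3.9 "Non-preservation of units" (kurims p. 72: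
the base `G = U ⋊ N`, `U = ℚ`, `N = (ℕ_{≥1})^gp` acting on `U` by `n⁻¹`; the monoid `Φ = V × W = ℚ × ℤ_{≥0}` on which
`g ↦ n` rescales `V`) [cite: MochizukiFrdI2008, Ex. 3.9 p.72].

abc-iut cell, block F, seat abc-iut-f-032 (gen 6); companion of abc-iut-f-023's `TemperedFrobenioidCor38SubOTriNegative`
(`OTriTwist.C` = Example 3.9 itself, whose vocabulary `OTriTwist.VW`, `χV`, `scaleQ`, `Ex39.act'`, `RatSemidirect.G` is
consumed BY NAME).  DATA, no claim about any paper: the Def. 3.3 (iii) / 3.6 (i) / 3.6 (ii) record obtained from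
Example 3.9 by restricting BOTH the base and the divisor monoid to their positive cones —
* base `D = D₀ = SingleObj W`, `W := {(u, n) ∈ G | u ≥ 0} = ℚ_{≥0} ⋊ N` (`cone`; a unit of `W` has `u = 0`,
  `u_eq_zero_of_isUnit`) — connected, and totally epimorphic because `W ⊆ G` is cancellative;
* `Φ₀ = Φ₀^ℝ = Φ := ℚ_{≥0} × ℤ_{≥0} ⊆ V × W` (`coneV`, functor `Φp`) with the inverse-convention pull-back
  `(v, w) ↦ (n⁻¹ v, w)` (`actp`), `B₀ = B₀^Λ = Φ^gp`, `Div = id`, `ℝ·Φ₀^cnst = F₀^Λ := Ker(V-coordinate)` (`ψVp`;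
  root-closed, `W`-stable), so that `Φ^{bs-fld} = 0 × ℤ_{≥0}` IS `ℤ`-monoprime (`bsFldEquiv`) and Def. 3.6 (ii)(b) holds
  (the constant `(0,1)` has divisor `(0,1)`); the [FrdI] vocabularies are the trivial `Toy.monoidVocab` / `catVocab`.
`ConeTwist.C : TemperedFrobenioid realified D catVocab` meets every REAL typed clause.  Parts 2–3
(`TemperedFrobenioidToyConeSwap`, `TemperedFrobenioidCor38SubConeNegative`) build Mochizuki's swap on this record and read
off a tightness certificate for row F-2809 `Cor38Hyp.PreservesPreSteps`.  The base is NOT of FSMFF-type (part 3), so this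
record inhabits no `Cor38Hyp`.  HONEST FRAMING: toy data over OUR typed interfaces; refereed pre-IUT material; nothing
here bears on the disputed [IUTchIII] Cor. 3.12; no side taken; typed ≠ proved.
-/

noncomputable section

namespace Literature.AnabelianGeometry.EtaleTheta

open CategoryTheory Opposite Literature.AlgebraicGeometry.Frobenioids

namespace ConeTwist

open RatSemidirect Ex39

/-! ### §1  The positive cones of Example 3.9 as typed Def. 3.3 (iii) / 3.6 (i) / 3.6 (ii) data -/

/-- The positive cone `W := ℚ_{≥0} ⋊ N ⊆ G = U ⋊ N` (translations `u ≥ 0`): a submonoid, since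
`(x·y).u = x.u + x.n⁻¹·y.u`. [cite: MochizukiFrdI2008, Ex. 3.9 p.72] -/
def cone : Submonoid G where
  carrier := {g | 0 ≤ g.u}
  one_mem' := by
    change (0 : ℚ) ≤ (1 : G).u
    rw [G.one_u]
  mul_mem' {x y} hx hy := by
    change (0 : ℚ) ≤ (x * y).u
    rw [G.mul_u]
    exact add_nonneg hx (mul_nonneg (inv_nonneg.mpr (le_of_lt x.n.2)) hy)

/-- `W = ℚ_{≥0} ⋊ N` as a monoid. [cite: MochizukiFrdI2008, Ex. 3.9 p.72] -/
abbrev W : Type := ↥cone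

/-- The base: the one-object category with endomorphism monoid `W`. [cite: MochizukiFrdI2008, Ex. 3.9 p.72] -/
abbrev D : Type := SingleObj W

/-- A unit of `W` has translation part `0` (its inverse in `G` has translation part `-n·u`).
[cite: MochizukiFrdI2008, Ex. 3.9 p.72] -/
theorem u_eq_zero_of_isUnit {w : W} (h : IsUnit w) : (w : G).u = 0 := by
  obtain ⟨x, rfl⟩ := h
  have h1 : ((x : W) : G).u + (((x : W) : G).n : ℚ)⁻¹ * ((↑(x⁻¹) : W) : G).u = 0 := by
    have h := congrArg (fun w : W => (w : G).u) x.mul_inv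
    change (((x : W) : G) * ((↑(x⁻¹) : W) : G)).u = (1 : G).u at h
    rwa [G.mul_u, G.one_u] at h
  have ha : 0 ≤ ((x : W) : G).u := (x : W).2
  have hb : 0 ≤ (((x : W) : G).n : ℚ)⁻¹ * ((↑(x⁻¹) : W) : G).u :=
    mul_nonneg (inv_nonneg.mpr (le_of_lt ((x : W) : G).n.2)) (↑(x⁻¹) : W).2
  linarith

/-- The positive cone `ℚ_{≥0} × ℤ_{≥0} ⊆ V × W = ℚ × ℤ_{≥0}` of the divisor monoid. [cite: MochizukiFrdI2008, Ex. 3.9 p.72] -/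
def coneV : Submonoid OTriTwist.VW where
  carrier := {z | 0 ≤ (Multiplicative.toAdd z).1}
  one_mem' := by
    change (0 : ℚ) ≤ (Multiplicative.toAdd (1 : OTriTwist.VW)).1
    rw [toAdd_one]
    exact le_rfl
  mul_mem' {a b} ha hb := by
    change (0 : ℚ) ≤ (Multiplicative.toAdd (a * b)).1
    rw [toAdd_mul]
    exact add_nonneg ha hb

/-- `Φ(•) = ℚ_{≥0} × ℤ_{≥0}`, multiplicatively. [cite: MochizukiFrdI2008, Ex. 3.9 p.72] -/
abbrev VWp : Type := ↥coneV

/-- The pull-back `(v, w) ↦ (n⁻¹·v, w)` along `g = (u, n) ∈ W` preserves the cone. [cite: MochizukiFrdI2008, Ex. 3.9 p.72] -/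
def actp (g : W) : VWp →* VWp :=
  ((act' (g : G)).restrict coneV).codRestrict coneV fun z => by
    change (0 : ℚ) ≤ (Multiplicative.toAdd (act' (g : G) (z : OTriTwist.VW))).1
    rw [toAdd_act']
    exact mul_nonneg (inv_nonneg.mpr (le_of_lt ((g : G).n).2)) z.2

/-- Values of `actp`. [cite: MochizukiFrdI2008, Ex. 3.9 p.72] -/
@[simp] theorem coe_actp (g : W) (z : VWp) : ((actp g z : VWp) : OTriTwist.VW) = act' (g : G) z := rfl

/-- `actp` is compatible with the product of `W`. [cite: MochizukiFrdI2008, Ex. 3.9 p.72] -/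
theorem actp_mul (g g' : W) : actp (g * g') = (actp g').comp (actp g) := by
  refine MonoidHom.ext fun z => Subtype.ext ?_
  change act' ((g : G) * (g' : G)) (z : OTriTwist.VW) = act' (g' : G) (act' (g : G) z)
  rw [act'_mul]
  rfl

/-- `actp 1 = id`. [cite: MochizukiFrdI2008, Ex. 3.9 p.72] -/
theorem actp_one : actp 1 = MonoidHom.id _ := by
  refine MonoidHom.ext fun z => Subtype.ext ?_
  change act' (1 : G) (z : OTriTwist.VW) = z
  rw [act'_one]
  rfl

/-- The monoid `Φ = ℚ_{≥0} × ℤ_{≥0}` on `D`, as a functor `Dᵒᵖ ⥤ CommMonCat`. [cite: MochizukiFrdI2008, Ex. 3.9 p.72] -/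
def Φp : Dᵒᵖ ⥤ CommMonCat.{0} where
  obj _ := CommMonCat.of VWp
  map f := CommMonCat.ofHom (actp (show W from f.unop))
  map_id A := by
    ext x : 2
    change actp 1 x = x
    rw [actp_one]
    rfl
  map_comp f g := by
    ext x : 2
    change actp ((show W from f.unop) * (show W from g.unop)) x = actp _ (actp _ x)
    rw [actp_mul]
    rfl

/-- The `V`-coordinate on the cone. [cite: MochizukiFrdI2008, Ex. 3.9 p.72] -/
def χVp : VWp →* Multiplicative ℚ := OTriTwist.χV.comp coneV.subtype

/-- The `V`-coordinate on the groupification `(ℚ_{≥0} × ℤ_{≥0})^gp → ℚ`. [cite: MochizukiFrdI2008, Ex. 3.9 p.72] -/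
def ψVp : Algebra.GrothendieckGroup VWp →* Multiplicative ℚ := Algebra.GrothendieckGroup.lift χVp

/-- `ψVp` extends `χVp`. [cite: MochizukiFrdI2008, Ex. 3.9 p.72] -/
@[simp] theorem ψVp_of (z : VWp) :
    ψVp (Algebra.GrothendieckGroup.of z) = Multiplicative.ofAdd (Multiplicative.toAdd (z : OTriTwist.VW)).1 := by
  have h := Algebra.GrothendieckGroup.lift.symm_apply_apply χVp
  rw [Algebra.GrothendieckGroup.lift_symm_apply] at h
  exact DFunLike.congr_fun h z

/-- The `V`-coordinate of a pull-back is the `V`-coordinate rescaled by `n⁻¹`. [cite: MochizukiFrdI2008, Ex. 3.9 p.72] -/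
theorem ψVp_comp_gpMap_actp (g : W) :
    ψVp.comp (gpMap (actp g)) = (OTriTwist.scaleQ (((g : G).n : ℚ)⁻¹)).comp ψVp :=
  MonGp.hom_ext fun z => by
    change ψVp (gpMap (actp g) (Algebra.GrothendieckGroup.of z)) =
      OTriTwist.scaleQ (((g : G).n : ℚ)⁻¹) (ψVp (Algebra.GrothendieckGroup.of z))
    rw [gpMap_of, ψVp_of, ψVp_of, coe_actp, toAdd_act']
    rfl

/-- `Ker(ψVp)` is stable under the pull-backs. [cite: MochizukiFrdI2008, Ex. 3.9 p.72] -/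
theorem mem_ker_ψVp_gpMap {g : W} {x : Algebra.GrothendieckGroup VWp} (hx : x ∈ ψVp.ker) :
    gpMap (actp g) x ∈ ψVp.ker := by
  rw [MonoidHom.mem_ker] at hx ⊢
  have h := DFunLike.congr_fun (ψVp_comp_gpMap_actp g) x
  rw [MonoidHom.comp_apply, MonoidHom.comp_apply, hx, map_one] at h
  exact h

/-- Def. 3.3 (iii) data: `Φ₀ := ℚ_{≥0} × ℤ_{≥0}` with `(u,n) ↦ (n⁻¹, 1)`, `B₀ := Φ₀^gp`, `div₀ = id`, `F₀ = 1`, nothing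
cuspidal, over `D₀ = D = SingleObj W`. [cite: MochizukiEtTh2009, Def 3.3 p.73] -/
def divisorMonoids : DivisorMonoids.{0, 0, 0} D where
  Φ₀ := Φp
  B₀ := monoidGp Φp
  isUnit_B₀ _ b := by
    change IsUnit (M := Algebra.GrothendieckGroup VWp) b
    exact Group.isUnit _
  div₀ _ := MonoidHom.id _
  div₀_natural _ _ := rfl
  F₀ _ := ⊥
  F₀_map _ _ hb := by
    rw [Submonoid.mem_bot] at hb ⊢
    rw [hb, map_one]
  ncsp₀ _ := ⊤
  csp₀ _ := ⊥
  ncsp₀_map _ _ _ := trivial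
  csp₀_map _ x hx := by
    rw [Submonoid.mem_bot] at hx ⊢
    rw [hx, map_one]
  existsUnique_ncsp_csp _ x := by
    refine ⟨(⟨x, trivial⟩, ⟨1, Submonoid.mem_bot.mpr rfl⟩), mul_one x, ?_⟩
    rintro ⟨a, c⟩ h
    have hc : c.1 = 1 := Submonoid.mem_bot.mp c.2
    have ha : a.1 = x := by
      have h' : a.1 * c.1 = x := h
      rwa [hc, mul_one] at h'
    exact Prod.ext (Subtype.ext ha) (Subtype.ext hc)

/-- Def. 3.6 (i) data (`Λ = ℤ`, `Φ₀^ℝ = Φ₀`, `B₀^Λ = Φ₀^gp`, `Div = id`) with `ℝ·Φ₀^cnst := Ker(ψVp)` (root-closed,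
`W`-stable) and `F₀^Λ :=` the same subgroup. [cite: MochizukiEtTh2009, Def 3.6 p.76] -/
def realified : RealifiedDivisorMonoids (D₀ := D) Toy.monoidVocab where
  toDivisorMonoids := divisorMonoids
  Λ := MonoidType.Z
  ΦR := Φp
  toR _ := MonoidHom.id _
  toR_natural _ _ := rfl
  isRealification _ := trivial
  BΛ := monoidGp Φp
  isUnit_BΛ _ b := by
    change IsUnit (M := Algebra.GrothendieckGroup VWp) b
    exact Group.isUnit _
  divΛ _ := MonoidHom.id _
  divΛ_natural _ _ := rfl
  FΛ _ := (ψVp).ker.toSubmonoid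
  FΛ_map f _ hb := mem_ker_ψVp_gpMap (g := show W from f.unop) hb
  cnstR _ := (ψVp).ker
  cnstR_map f _ hx := mem_ker_ψVp_gpMap (g := show W from f.unop) hx
  divΛ_mem_cnstR _ _ hb := hb
  cnstR_root _ g n hg := by
    have hg' : ψVp g ^ (n : ℕ) = 1 := by rw [← map_pow]; exact hg
    have h : (n : ℕ) • Multiplicative.toAdd (ψVp g) = 0 := by
      have := congrArg Multiplicative.toAdd hg'
      rwa [toAdd_pow, toAdd_one] at this
    show ψVp g = 1
    rcases smul_eq_zero.mp h with h | h
    · exact absurd h n.ne_zero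
    · exact congrArg Multiplicative.ofAdd h
  cnst_le_cnstR _ b hb := by
    have hb' : b = 1 := Submonoid.mem_bot.mp hb
    subst hb'
    show ψVp (gpMap (MonoidHom.id VWp) (MonoidHom.id _ 1)) = 1
    rw [map_one, map_one, map_one]
  ncspR _ := ⊤
  cspR _ := ⊥
  toR_ncsp _ _ _ := trivial
  toR_csp _ _ hx := hx

/-- The trivial [FrdI] category vocabulary on `D = SingleObj W`. [cite: MochizukiEtTh2009, Def 3.6 p.77] -/
def catVocab : FrdICatStub.{0, 0, 0} D where
  IsDivisorialOn _ := True
  IsRational _ := True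
  IsStrictlyRational _ := True

/-- The generator-free element `(0, w)` of the cone, for `w ∈ ℤ_{≥0}`. [cite: MochizukiFrdI2008, Ex. 3.9 p.72] -/
def zw (w : ℕ) : VWp := ⟨Multiplicative.ofAdd ((0 : ℚ), w), le_refl (0 : ℚ)⟩

/-- `(0, w)` lies in `Ker(ψVp)`. [cite: MochizukiFrdI2008, Ex. 3.9 p.72] -/
theorem of_zw_mem_ker (w : ℕ) : Algebra.GrothendieckGroup.of (zw w) ∈ (ψVp).ker := by
  rw [MonoidHom.mem_ker, ψVp_of]
  rfl

/-- `Φ^{bs-fld} = 0 × ℤ_{≥0} ≅ ℤ_{≥0}`: the isomorphism `(0, w) ↦ w`. [cite: MochizukiEtTh2009, Def 3.6 p.77] -/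
def bsFldEquiv :
    ↥((⊤ : Submonoid VWp) ⊓ ((ψVp).ker).toSubmonoid.comap Algebra.GrothendieckGroup.of) ≃* Multiplicative ℕ where
  toFun z := Multiplicative.ofAdd (Multiplicative.toAdd ((z.1 : VWp) : OTriTwist.VW)).2
  invFun k := ⟨zw (Multiplicative.toAdd k), Submonoid.mem_top _, of_zw_mem_ker _⟩
  left_inv z := by
    obtain ⟨⟨z, hz0⟩, -, hz⟩ := z
    apply Subtype.ext
    apply Subtype.ext
    change Multiplicative.ofAdd ((0 : ℚ), (Multiplicative.toAdd z).2) = z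
    have hz' : ψVp (Algebra.GrothendieckGroup.of ⟨z, hz0⟩) = 1 := hz
    rw [ψVp_of] at hz'
    have h1 : (Multiplicative.toAdd z).1 = 0 := Multiplicative.ofAdd.injective hz'
    exact Multiplicative.toAdd.injective (Prod.ext h1.symm rfl)
  right_inv k := by simp [zw]
  map_mul' z z' := by
    change Multiplicative.ofAdd (Multiplicative.toAdd (((z.1 * z'.1 : VWp)) : OTriTwist.VW)).2 = _
    rw [Submonoid.coe_mul, toAdd_mul, Prod.snd_add, ofAdd_add]

/-- **The typed tempered-Frobenioid interface is satisfied by the positive cones of Example 3.9**: `D = D₀ = SingleObj W`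
(connected; totally epimorphic because `W ⊆ G` is cancellative), `Φ = Φ^{ℝ-log} = ℚ_{≥0} × ℤ_{≥0}` (group-saturated),
`Φ^{bs-fld} = 0 × ℤ_{≥0}` monoprime (REAL `IsMonoprime`), Def. 3.6 (ii)(b): the constant of divisor `(0,1) ≠ 0`.
[cite: MochizukiEtTh2009, Def 3.6 p.77] -/
def C : TemperedFrobenioid realified D catVocab where
  isConnected := zigzag_isConnected fun _ _ => Relation.ReflTransGen.refl
  isTotallyEpimorphic := ⟨fun f => ⟨fun g h e => by
    have e' : (show W from g) * (show W from f) = (show W from h) * (show W from f) := e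
    exact (Subtype.ext (mul_right_cancel (congrArg Subtype.val e')) : (show W from g) = (show W from h))⟩⟩
  base := 𝟭 D
  Φ := ⟨fun _ => ⊤, fun _ _ _ => trivial⟩
  isGroupSaturated A := (isGroupSaturated_iff' _).2 fun _ _ _ _ _ _ => trivial
  isPerfFactorial _ := trivial
  isDivisorialOn := trivial
  isMonoprime_bsFld _ := IsMonoprime.ofZ ⟨⟨bsFldEquiv⟩⟩
  exists_FΛ_div_ne _ := ⟨Algebra.GrothendieckGroup.of (zw 1), of_zw_mem_ker 1, zw 1, trivial, 1, trivial,
    ne_of_apply_ne (fun z : VWp => (Multiplicative.toAdd (z : OTriTwist.VW)).2) (show (1 : ℕ) ≠ 0 from one_ne_zero),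
    by rw [map_one, div_one]; rfl⟩

end ConeTwist

end Literature.AnabelianGeometry.EtaleTheta

end
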